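import Literature.NumberTheory.LFunctions.SubnormalZetaGapsKappa
import Literature.NumberTheory.LFunctions.ConreyIwaniec2002MeanValues
import Literature.NumberTheory.LFunctions.ZeroStatistics
import Literature.NumberTheory.LFunctions.AlternativeHypothesis
import HarnessLib

/-!
# Route `PrimeLevelFamEdge` — TYPED IDEA DELTAS, deck 17: «CI-GAPS is an ¬AH door» — the Conrey–Iwaniec
# consumer re-typed on OFF-LATTICE pairs (cell ls-idea, seat ls-idea-lens-22 `transfer` × CI-GAPS, card K-L22-1;
# critic F b3 PASS, ★-recommended; LANDING NOTE typer ls-idea-typ-1 gen 2: the seat's `Sketch_L22.lean` sha16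
# 9cef396138fd1abc VERBATIM up to (i) namespace `…Sketch.Lens22` → the deck namespace `.SincDoor`, (ii) the four
# 0-ary targets made PARAMETRIC — `SincDoorTarget κ` in the gap exponent, `OddSlopeOfPlateauTarget ε` /
# `OddSlopeTransferTarget ε` / `AHPairsKillsOddSlopeTarget ε` in the detector width (the seat's forms are the
# `∀ κ` / `∀ ε` closures), (iii) three missing docstrings added.)

HONESTY: no exceptional-zero theorem (no Landau–Siegel / Siegel-zero exclusion, no Theorem 1–2 of
arXiv:2211.02515, no repaired Margin232) is proved here; typed ≠ proved; computed ≠ proved. This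
file only DEFINES predicates on tree objects and proves elementary inclusions between them.

What is typed (all over existing declarations, `lean search`ed):
* `HasSincCompanion L w γ` — `½+iγ` is a critical zero of `L` which is multiple, or has a critical
  zero `½+iγ′ ≠ ½+iγ` with `|sinc((γ−γ′)·log γ)| ≥ w` (the summand `ConreyIwaniec2002.sincTerm` of
  the principal estimate (9.12), tree `conreyIwaniec2002_proposition92`, whose companions
  `t′ : ℝ → ℝ` are UNRESTRICTED). `sinc((γ−γ′)log γ)` vanishes exactly when the normalised
  distance `u = (γ−γ′)log γ/2π` lies in `½ℤ ∖ {0}` = the Alternative-Hypothesis lattice.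
* `SincCompanionHypothesis κ c w` = «X_sinc»: for all large `T`, at least `c·T·(log T)^{1−κ}`
  ordinates `2 ≤ γ ≤ T` have a sinc-companion of weight `≥ w`. PROVED here:
  `SubnormalGapsHypothesisKappa κ α → SincCompanionHypothesis κ 1 α` (`0 ≤ α ≤ 1`; CI (10.8) =
  tree `le_sincTerm_of_abs_sub_le`): the widened door CONTAINS the K6-5 ledger `H(κ,α)`.
* `SincDoorTarget` — the consumer statement to be PROVED by a typist/prover from the named fact
  `conreyIwaniec2002_proposition92` (same architecture as the tree's
  `conreyIwaniec2002_corollary102_of_proposition101`; exponent `(18+6κ)/(1−κ)`, = K6-5's `4A+18`).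
* `oddSlopeDetector ε u = u·sin(2πu)·sinc(πεu/2)⁴` (≡ 0 on `½ℤ`, Fourier support
  `±[1−ε,1+ε]`), `detectorPairSum`, `OddSlopeHypothesis ε η` (the CRUX = first non-transferring
  step of the ported bridge), `FormFactorPlateauNear η ε` (PC at support `1+ε` only), and the two
  transfer targets `OddSlopeTransferTarget` (RH-side) / `OddSlopeOfPlateauTarget` (PC-side).
Nothing is asserted; the `…Target` / `…Hypothesis` names are `Prop`-valued definitions.
-/

noncomputable section

open Complex Filter

namespace Summit.Parity.GeneralizedHardyLittlewood.Theorems.PrimeLevelFamEdgeIdeaDeltas.SincDoor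

open Literature.NumberTheory.LFunctions Literature.NumberTheory.LFunctions.ConreyIwaniec2002

/-! ### The widened door `X_sinc` -/

/-- `½ + iγ` is a critical zero of `L` which is a multiple zero, or has a critical companion
`½ + iγ′`, `γ′ ≠ γ`, at sinc-weight `|sinc((γ − γ′)·log γ)| ≥ w` (CI 2002 (9.12) summand). -/
def HasSincCompanion (L : ℂ → ℂ) (w γ : ℝ) : Prop :=
  L (1 / 2 + γ * I) = 0 ∧
    (deriv L (1 / 2 + γ * I) = 0 ∨
      ∃ γ' : ℝ, γ' ≠ γ ∧ L (1 / 2 + γ' * I) = 0 ∧ w ≤ sincTerm γ γ')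

/-- Ordinates `2 ≤ γ ≤ T` of critical zeros of `L` with a sinc-companion of weight `≥ w`. -/
def sincCompanionOrdinates (L : ℂ → ℂ) (w T : ℝ) : Set ℝ :=
  {γ : ℝ | 2 ≤ γ ∧ γ ≤ T ∧ HasSincCompanion L w γ}

/-- **`X_sinc(κ, c, w)`**: for all large `T` at least `c·T·(log T)^{1−κ}` ordinates `2 ≤ γ ≤ T` of
critical zeros of `ζ` have a sinc-companion of weight `≥ w`. Content requires `0 < c`, `0 < w`
(for `w ≤ 0` the companion condition is «some other critical zero exists»; for `κ = 0` the count
must stay below `N(T) ∼ (T/2π) log T`, so `c < 1/2π`). Never asserted. -/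
def SincCompanionHypothesis (κ c w : ℝ) : Prop :=
  ∃ T₀ : ℝ, ∀ T : ℝ, T₀ ≤ T →
    c * T * Real.log T ^ (1 - κ) ≤ ((sincCompanionOrdinates riemannZeta w T).ncard : ℝ)

/-- CI (10.8): a companion within `π(1−α)/log γ` has sinc-weight `≥ α`. -/
theorem hasSincCompanion_of_hasCloseZero {L : ℂ → ℂ} {α γ : ℝ} (hα0 : 0 ≤ α) (hα1 : α ≤ 1)
    (hγ : 1 < γ) (h : HasCloseZero L (gapRadius α γ) γ) : HasSincCompanion L α γ := by
  refine ⟨h.1, ?_⟩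
  rcases h.2 with hd | ⟨γ', hne, hz, hdist⟩
  · exact Or.inl hd
  · exact Or.inr ⟨γ', hne, hz, le_sincTerm_of_abs_sub_le hα0 hα1 hγ hdist⟩

/-- The K6-5 close-zero ordinates are sinc-companion ordinates at the same weight (`0 ≤ α ≤ 1`). -/
theorem closeZeroOrdinates_subset_sincCompanionOrdinates (L : ℂ → ℂ) {α : ℝ} (hα0 : 0 ≤ α)
    (hα1 : α ≤ 1) (T : ℝ) : closeZeroOrdinates L α T ⊆ sincCompanionOrdinates L α T := by
  intro γ hγ
  obtain ⟨h2, hT, hc⟩ := hγ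
  exact ⟨h2, hT, hasSincCompanion_of_hasCloseZero hα0 hα1 (by linarith) hc⟩

/-- The counted set is finite (it injects into the tree's `zetaZeroBox (1/2) T`). -/
theorem sincCompanionOrdinates_finite (w T : ℝ) :
    (sincCompanionOrdinates riemannZeta w T).Finite := by
  have hinj : Set.InjOn (fun γ : ℝ ↦ (1 / 2 : ℂ) + γ * I)
      ((fun γ : ℝ ↦ (1 / 2 : ℂ) + γ * I) ⁻¹' zetaZeroBox (1 / 2) T) := by
    intro a _ b _ h
    have him := congrArg Complex.im h
    simpa using him
  refine ((zetaZeroBox_finite (1 / 2) T).preimage hinj).subset ?_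
  intro γ hγ
  obtain ⟨h2, hT, hz, _⟩ := hγ
  simp only [Set.mem_preimage, zetaZeroBox, Set.mem_setOf_eq]
  refine ⟨hz, ?_, ?_, ?_, ?_⟩ <;> simp <;> linarith

/-- **The widened door contains the K6-5 ledger**: `H(κ, α) ⇒ X_sinc(κ, 1, α)` for `0 ≤ α ≤ 1`. -/
theorem sincCompanionHypothesis_of_kappa {κ α : ℝ} (hα0 : 0 ≤ α) (hα1 : α ≤ 1)
    (h : SubnormalGapsHypothesisKappa κ α) : SincCompanionHypothesis κ 1 α := by
  obtain ⟨T₀, hT⟩ := h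
  refine ⟨T₀, fun T hTT ↦ ?_⟩
  rw [one_mul]
  refine le_trans (hT T hTT) ?_
  exact_mod_cast Set.ncard_le_ncard
    (closeZeroOrdinates_subset_sincCompanionOrdinates riemannZeta hα0 hα1 T)
    (sincCompanionOrdinates_finite α T)

/-- **TARGET T-L22-C (consumer; to be PROVED from the named fact Prop 9.2, not asserted)**: the
widened door theorem `X_sinc(κ,c,w) ⇒ L(1,χ) ≥ c′(log q)^{−(18+6κ)/(1−κ)}` for odd real primitive
`χ` mod odd `q > 4` (CI §7 scope). Route: one zero per even/odd unit window
(`ConreyIwaniec2002.exists_separated_subset`, `card_filter_round_eq_le`), companions = the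
sinc-companions (zeros of `ζ`, hence of `ζ_K = L(s,1)`: divided difference `0`,
`dividedDifference_eq_zero_of_zeros` / derivative `0`), then (9.12) with `Δ(T) = 0` and
`log T = (C′(log q)^6)^{1/(1−κ)}`. PARAMETRIC in the gap exponent `κ` (the seat's target is `∀ κ, SincDoorTarget κ`). -/
def SincDoorTarget (κ : ℝ) : Prop :=
  conreyIwaniec2002_proposition92 →
    ∀ c w : ℝ, 0 ≤ κ → κ < 1 → 0 < c → 0 < w → SincCompanionHypothesis κ c w →
      ∃ c' : ℝ, 0 < c' ∧
        ∀ (q : ℕ) [NeZero q], 4 < q → Odd q → ∀ χ : DirichletCharacter ℂ q,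
          χ.IsPrimitive → χ.IsQuadratic → χ.Odd →
            c' * Real.log q ^ (-((18 + 6 * κ) / (1 - κ))) ≤ ‖χ.LFunction 1‖

/-! ### The producer side: the odd-across-1 detector (first non-transferring step) -/

/-- `r_ε(u) = u · sin(2πu) · sinc(πεu/2)⁴`: even, real, `r_ε ≡ 0` on `½ℤ` (so no diagonal term and
no charge on AH-lattice pairs), `|r_ε(u)| ≪ min(|u|, |u|^{−3})`, Fourier transform supported in
`[−1−ε, −1+ε] ∪ [1−ε, 1+ε]` (`sinc(πεu/2)⁴` has transform = cubic B-spline on `[−ε, ε]`). -/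
def oddSlopeDetector (ε u : ℝ) : ℝ :=
  u * Real.sin (2 * Real.pi * u) * Real.sinc (Real.pi * ε * u / 2) ^ 4

/-- No charge on the Alternative-Hypothesis lattice `½ℤ` (in particular none on the diagonal). -/
theorem oddSlopeDetector_halfInt (ε : ℝ) (k : ℤ) : oddSlopeDetector ε (k / 2) = 0 := by
  unfold oddSlopeDetector
  have h : Real.sin (2 * Real.pi * (k / 2 : ℝ)) = 0 := by
    rw [show 2 * Real.pi * (k / 2 : ℝ) = (k : ℝ) * Real.pi by ring]
    exact Real.sin_int_mul_pi k
  simp [h]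

/-- No diagonal charge: `r_ε(0) = 0`. -/
theorem oddSlopeDetector_zero (ε : ℝ) : oddSlopeDetector ε 0 = 0 := by
  simp [oddSlopeDetector]

/-- The detector is even in `u`. -/
theorem oddSlopeDetector_neg (ε u : ℝ) : oddSlopeDetector ε (-u) = oddSlopeDetector ε u := by
  unfold oddSlopeDetector
  rw [show 2 * Real.pi * -u = -(2 * Real.pi * u) by ring, Real.sin_neg,
    show Real.pi * ε * -u / 2 = -(Real.pi * ε * u / 2) by ring, Real.sinc_neg]
  ring

/-- The detector pair sum `D_ε(T) = Σ_{0<γ,γ′≤T} r_ε((γ−γ′)·log T/2π)·w(γ−γ′)` over pairs of zeros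
with multiplicity (`zeroIndexSet`, as in `montgomeryFormFactor`), Montgomery weight `w(u)=4/(4+u²)`.
By the explicit definition of `F(α,T)`: `D_ε(T) = (T log T/2π)·∫ r̂_ε(α) F(α,T) dα`, and since `r̂_ε`
lives on `±[1−ε,1+ε]` and `ĝ′` is odd, `∫ r̂_ε F = c·∫₀^ε ĝ′(β)·[F(1+β,T) − F(1−β,T)] dβ`. -/
def detectorPairSum (ε T : ℝ) : ℝ :=
  ∑ p ∈ zeroIndexSet T ×ˢ zeroIndexSet T,
    oddSlopeDetector ε ((zetaOrdinate p.1 - zetaOrdinate p.2) * Real.log T / (2 * Real.pi)) *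
      montgomeryWeight (zetaOrdinate p.1 - zetaOrdinate p.2)

/-- **CRUX K-L22-1 `OddSlope(ε, η)`** (the first NON-transferring step of the ported bridge): the
one-test-function pair-correlation functional `D_ε` is NOT `o(N(T))`: `|D_ε(T)| ≥ η·N(T)` for all
large `T`. Value table: GUE/PC gives `D_ε ∼ c_ε·N`, `c_ε = 2c∫₀^ε β ĝ′(β)dβ ≠ 0`; the AH lattice
`½ℤ` (and the (A)-world at CI heights, triangle `F = 2 − α` on `[1,2]`) gives `D_ε = o(N)`. Under
RH it is implied by the form-factor plateau on `[1, 1+ε]` ALONE (`FormFactorPlateauNear`), i.e. by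
Hardy–Littlewood on average over shifts `h ≤ x^{ε/(1+ε)}` with power saving (Goldston–Montgomery
dictionary) — parity-barrier class; never asserted. -/
def OddSlopeHypothesis (ε η : ℝ) : Prop :=
  ∃ T₀ : ℝ, ∀ T : ℝ, T₀ ≤ T → η * (zetaZeroCount T : ℝ) ≤ |detectorPairSum ε T|

/-- **PC at support `1 + ε` only**: `F(α, T) → 1` uniformly for `α ∈ [1, 1+ε]` within `η`
eventually (a fragment of `MontgomeryStrongPairCorrelation`, which asks it for every `|α| ≥ 1`). -/
def FormFactorPlateauNear (η ε : ℝ) : Prop :=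
  ∃ T₀ : ℝ, ∀ T : ℝ, T₀ ≤ T → ∀ α : ℝ, 1 ≤ α → α ≤ 1 + ε →
    |montgomeryFormFactor α T - 1| ≤ η

/-- **TARGET T-L22-P1 (PC-side, RH + Montgomery's theorem on `[1−ε, 1)`; analysis-grade)**: a
plateau on `[1, 1+ε]` within small `η` forces `OddSlope(ε, η′)` with `η′ ≍ |∫₀^ε βĝ′|`. PARAMETRIC in the
detector width `ε` (the seat's target is `∀ ε, OddSlopeOfPlateauTarget ε`). -/
def OddSlopeOfPlateauTarget (ε : ℝ) : Prop :=
  RiemannHypothesis → 0 < ε → ε < 1 →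
    ∃ η : ℝ, 0 < η ∧ (FormFactorPlateauNear η ε → ∃ η' : ℝ, 0 < η' ∧ OddSlopeHypothesis ε η')

/-- **TARGET T-L22-P2 (RH-side transfer; theorem-grade inputs: Montgomery's band-limited majorant
for the tail `|u| > K` and the near-lattice strip, Hejhal's RH triple-correlation majorant to pass
from `≫ N` weighted pairs to `≫ N` distinct ordinates, Jensen's `O(log T)` zeros per unit window to
pass to `≫ T` ordinates `≥ 2`)**: `OddSlope ⇒ X_sinc(0, c, w)`. PARAMETRIC in the detector width `ε`. -/
def OddSlopeTransferTarget (ε : ℝ) : Prop :=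
  RiemannHypothesis → ∀ η : ℝ, 0 < ε → ε < 1 → 0 < η → OddSlopeHypothesis ε η →
    ∃ c w : ℝ, 0 < c ∧ 0 < w ∧ SincCompanionHypothesis 0 c w

/-- **AH side of the separation** (typed target, NOT proved; the D1 separating model of the card):
under RH, every AH-Pairs world (BGSTB 2025 §1, tree predicate `AHPairs`) makes the odd-slope
statistic `o(N(T))`: `oddSlopeDetector ε` vanishes on `½ℤ` (`oddSlopeDetector_halfInt`) and is
Lipschitz, AH-Pairs puts every pair with `|u| ≤ M` within `C(|k|+1)R(T) → 0` of `½ℤ`, and the tail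
`|u| > M` is `≤ ε_M · N` by a Montgomery majorant (RH); letting `M → ∞` gives `¬ OddSlopeHypothesis ε η`
for every `η > 0`. Print form: BGSTB 2025 Theorem 3 (tree NAMED FACT `bgstb2025_theorem3`,
`AlternativeHypothesisFormFactor.lean`): `F(1+β)` and `F(1−β)` agree under RH + AH-Pairs up to the
one-sided mass `2(P₀−1)δ₁⁺`, which meets `ĝ′(0) = 0`; Baluyot 2016 Thm 1.3 (A2) (periodic `|α|`). PARAMETRIC in
the detector width `ε`. -/
def AHPairsKillsOddSlopeTarget (ε : ℝ) : Prop :=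
  RiemannHypothesis → AHPairs →
    ∀ η : ℝ, 0 < ε → ε < 1 → 0 < η → ¬ OddSlopeHypothesis ε η

end Summit.Parity.GeneralizedHardyLittlewood.Theorems.PrimeLevelFamEdgeIdeaDeltas.SincDoor

end
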